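import Summits.QuantumFields.BalabanUV.Beta.GAN24.DirichletBoxRegularity

/-!
# `BalabanUV.Beta.GAN24.DirichletRingGreen` — binder row G-an2-4 / (CONV-C), road P2 PART IV, leaf L4 of the ring lemma: THE DISCRETE GREEN
# IDENTITY ON AN ARBITRARY FINITE SITE SET (interior bond energy + boundary flux; unit b2b-balaban-gan24-p2, gen 24, v1)

HONEST FRAMING (cell contract, verbatim): «discharging `BetaPertH` makes Bałaban's UV stability UNCONDITIONAL — a real constructive-QFT
result; it is NOT the continuum limit and NOT the Clay problem.»  Lattice-calculus brick for the ring lemma of memo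
`HOME/b2b-balaban-gan24-p2/gen24/W-FULL-WEIGHTED.md` §3 (leaf L4): summation by parts of `Σ_{x∈A} z̄(x)(P_μz)(x)` over an ARBITRARY finite
set `A` of torus sites (in the ring lemma `A = Q_k(c)`, a lattice square around a re-entrant vertex), `P_μ = ∂_μᴴ∂_μ` the directional
second difference of module M-R:
 * **`sum_conj_mul_Pdir_eq`** — `Σ_{x∈A} z̄(x)(P_μz)(x) = c̄c·[ Σ_{x∈A, x+e∈A}|z(x+e) − z(x)|² + Σ_{x∈A, x+e∉A} z̄(x)(z(x) − z(x+e))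
   + Σ_{x∈A, x−e∉A} z̄(x)(z(x) − z(x−e)) ]` (a COMPLEX identity: interior `μ`-bonds of `A` give their energy, boundary bonds give the flux terms);
 * **`sum_conj_mul_LapS_eq`** — the same summed over the directions for `Δ = Σ_μ P_μ`.
For `z ⊂ Ω` the boundary terms at bonds leaving `Ω` are the Dirichlet energies `|z(x)|²`; at bonds leaving `A` inside `Ω` they are the flux
through `∂A` that the ring lemma bounds by the Wirtinger inequality of `DirichletRingWirtinger` (L1) — that split is the consumer's (L5).

ABSOLUTE RULE (cell, verbatim): «No internally-minted statement may enter as a cited fact. Every hypothesis is either kernel-proved in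
this package or a verbatim quotation of a PUBLISHED theorem with page reference. The manuscript(s) under audit are NOT citable for
their own disputed steps — they are the thing under adjudication; programme-internal (2001/route/tribunal) claims are never citable.»
[folklore] finite lattice calculus; nothing printed is a hypothesis.  NOT CLAIMED: the ring lemma (L5–L8), (A)/(B), NE2, (CONV-C), `BetaPertH`,
continuum, Clay.  «not in print; our proof attempt».  HONEST DEPENDENCY: continuum YM on T⁴ ⇐ BetaPertH ∧ nine spine estimates (0/9 proved);
BetaPertH ⇐ (D1) ∧ (D4) ∧ CAP+tail; G-an2-4 gates asym, D1 and NE2/3/4.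
-/

noncomputable section

open scoped BigOperators ComplexConjugate Matrix
open Finset

namespace Summit.QuantumFields.BalabanUV.Beta.GAN24.DirichletRingGreen

open Literature.MathematicalPhysics.QuantumFieldTheory.Balaban1983to89.B5Prop11Plancherel (Tor unitVec)
open Literature.MathematicalPhysics.QuantumFieldTheory.Balaban1983to89.B5Action121 (sdiff LapS)
open Summit.QuantumFields.BalabanUV.Beta.GAN24.DirichletBoxRegularity (Pdir Pdir_mulVec LapS_mulVec_eq_sum)

variable {d : ℕ} (N : Fin d → ℕ) [hN : ∀ μ, NeZero (N μ)]

/-- re-indexing a sum over `{x ∈ A : x − e ∈ A}` by `x ↦ x − e` onto `{y ∈ A : y + e ∈ A}`. [folklore] -/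
theorem sum_filter_sub_mem_eq (A : Finset (Tor N)) (e : Tor N) (F : Tor N → ℂ) :
    ∑ x ∈ A.filter (fun x => x - e ∈ A), F x = ∑ y ∈ A.filter (fun y => y + e ∈ A), F (y + e) := by
  classical
  -- both sides as indicator sums over the whole torus, related by the translation `y ↦ y + e`
  have hL : ∑ x ∈ A.filter (fun x => x - e ∈ A), F x = ∑ x, (if (x ∈ A ∧ x - e ∈ A) then F x else 0) := by
    rw [← Finset.sum_filter]
    congr 1
    ext x
    simp [Finset.mem_filter]
  have hR : ∑ y ∈ A.filter (fun y => y + e ∈ A), F (y + e) = ∑ y, (if (y ∈ A ∧ y + e ∈ A) then F (y + e) else 0) := by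
    rw [← Finset.sum_filter]
    congr 1
    ext y
    simp [Finset.mem_filter]
  rw [hL, hR]
  refine (Fintype.sum_equiv (Equiv.addRight e) _ _ (fun y => ?_)).symm
  rw [Equiv.coe_addRight, add_sub_cancel_right]
  by_cases h1 : y ∈ A <;> by_cases h2 : y + e ∈ A <;> simp [h1, h2]

/-- **THE DISCRETE GREEN IDENTITY, one direction**: for every finite site set `A`, every field `z` and lattice factor `c`,
`Σ_{x∈A} z̄(x)(P_μz)(x) = c̄c·[ Σ_{x∈A, x+e_μ∈A}|z(x+e_μ) − z(x)|² + Σ_{x∈A, x+e_μ∉A} z̄(x)(z(x) − z(x+e_μ)) + Σ_{x∈A, x−e_μ∉A} z̄(x)(z(x) − z(x−e_μ)) ]`.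
[folklore] -/
theorem sum_conj_mul_Pdir_eq (A : Finset (Tor N)) (c : ℂ) (μ : Fin d) (z : Tor N → ℂ) :
    ∑ x ∈ A, conj (z x) * (Pdir N c μ *ᵥ z) x
      = conj c * c *
        ( ∑ x ∈ A.filter (fun x => x + unitVec N μ ∈ A), ((‖z (x + unitVec N μ) - z x‖ ^ 2 : ℝ) : ℂ)
          + ∑ x ∈ A.filter (fun x => x + unitVec N μ ∉ A), conj (z x) * (z x - z (x + unitVec N μ))
          + ∑ x ∈ A.filter (fun x => x - unitVec N μ ∉ A), conj (z x) * (z x - z (x - unitVec N μ)) ) := by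
  classical
  set e := unitVec N μ with he
  -- expand the stencil: `z̄(2z − z₊ − z₋) = z̄(z − z₊) + z̄(z − z₋)`
  have hexp : ∑ x ∈ A, conj (z x) * (Pdir N c μ *ᵥ z) x
      = conj c * c * (∑ x ∈ A, conj (z x) * (z x - z (x + e)) + ∑ x ∈ A, conj (z x) * (z x - z (x - e))) := by
    rw [← Finset.sum_add_distrib, Finset.mul_sum]
    refine Finset.sum_congr rfl fun x _ => ?_
    rw [Pdir_mulVec, ← he]
    ring
  rw [hexp]
  congr 1
  -- split both sums by the position of the neighbour
  have hS1 : ∑ x ∈ A, conj (z x) * (z x - z (x + e))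
      = ∑ x ∈ A.filter (fun x => x + e ∈ A), conj (z x) * (z x - z (x + e))
        + ∑ x ∈ A.filter (fun x => x + e ∉ A), conj (z x) * (z x - z (x + e)) :=
    (Finset.sum_filter_add_sum_filter_not A (fun x => x + e ∈ A) _).symm
  have hS2 : ∑ x ∈ A, conj (z x) * (z x - z (x - e))
      = ∑ x ∈ A.filter (fun x => x - e ∈ A), conj (z x) * (z x - z (x - e))
        + ∑ x ∈ A.filter (fun x => x - e ∉ A), conj (z x) * (z x - z (x - e)) :=
    (Finset.sum_filter_add_sum_filter_not A (fun x => x - e ∈ A) _).symm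
  -- re-index the interior part of the second sum and combine the two interior parts into the bond energies
  have hre : ∑ x ∈ A.filter (fun x => x - e ∈ A), conj (z x) * (z x - z (x - e))
      = ∑ y ∈ A.filter (fun y => y + e ∈ A), conj (z (y + e)) * (z (y + e) - z y) := by
    rw [sum_filter_sub_mem_eq N A e (fun x => conj (z x) * (z x - z (x - e)))]
    refine Finset.sum_congr rfl fun y _ => ?_
    rw [add_sub_cancel_right]
  have hint : ∑ x ∈ A.filter (fun x => x + e ∈ A), conj (z x) * (z x - z (x + e))
      + ∑ y ∈ A.filter (fun y => y + e ∈ A), conj (z (y + e)) * (z (y + e) - z y)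
      = ∑ x ∈ A.filter (fun x => x + e ∈ A), ((‖z (x + e) - z x‖ ^ 2 : ℝ) : ℂ) := by
    rw [← Finset.sum_add_distrib]
    refine Finset.sum_congr rfl fun x _ => ?_
    rw [← Complex.normSq_eq_norm_sq, Complex.normSq_eq_conj_mul_self, map_sub]
    ring
  rw [hS1, hS2, hre, ← hint]
  ring

/-- **THE DISCRETE GREEN IDENTITY for `Δ = Σ_μ ∂_μᴴ∂_μ`** on an arbitrary finite site set. [folklore] -/
theorem sum_conj_mul_LapS_eq (A : Finset (Tor N)) (c : ℂ) (z : Tor N → ℂ) :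
    ∑ x ∈ A, conj (z x) * (LapS N c *ᵥ z) x
      = conj c * c * ∑ μ : Fin d,
        ( ∑ x ∈ A.filter (fun x => x + unitVec N μ ∈ A), ((‖z (x + unitVec N μ) - z x‖ ^ 2 : ℝ) : ℂ)
          + ∑ x ∈ A.filter (fun x => x + unitVec N μ ∉ A), conj (z x) * (z x - z (x + unitVec N μ))
          + ∑ x ∈ A.filter (fun x => x - unitVec N μ ∉ A), conj (z x) * (z x - z (x - unitVec N μ)) ) := by
  classical
  calc ∑ x ∈ A, conj (z x) * (LapS N c *ᵥ z) x
      = ∑ x ∈ A, ∑ μ, conj (z x) * (Pdir N c μ *ᵥ z) x := by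
        refine Finset.sum_congr rfl fun x _ => ?_
        rw [LapS_mulVec_eq_sum, Finset.mul_sum]
    _ = ∑ μ, ∑ x ∈ A, conj (z x) * (Pdir N c μ *ᵥ z) x := Finset.sum_comm
    _ = _ := by
        rw [Finset.mul_sum]
        exact Finset.sum_congr rfl fun μ _ => sum_conj_mul_Pdir_eq N A c μ z

/-- **THE ENERGY FORM** (real part): for every finite `A`, field `z`, factor `c`,
`Re Σ_{x∈A} z̄(x)(Δz)(x) = |c|²·Σ_μ[ Σ_{x∈A, x+e_μ∈A}|z(x+e_μ) − z(x)|² + Re Σ_{x∈A, x+e_μ∉A} z̄(x)(z(x) − z(x+e_μ)) + Re Σ_{x∈A, x−e_μ∉A} z̄(x)(z(x) − z(x−e_μ)) ]`.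
If `z` vanishes at an exterior neighbour the corresponding flux term is the Dirichlet energy `|z(x)|² ≥ 0`; the others are the flux through
`∂A` (ring lemma, L5). [folklore] -/
theorem re_sum_conj_mul_LapS_eq (A : Finset (Tor N)) (c : ℂ) (z : Tor N → ℂ) :
    (∑ x ∈ A, conj (z x) * (LapS N c *ᵥ z) x).re
      = ‖c‖ ^ 2 * ∑ μ : Fin d,
        ( ∑ x ∈ A.filter (fun x => x + unitVec N μ ∈ A), ‖z (x + unitVec N μ) - z x‖ ^ 2
          + (∑ x ∈ A.filter (fun x => x + unitVec N μ ∉ A), conj (z x) * (z x - z (x + unitVec N μ))).re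
          + (∑ x ∈ A.filter (fun x => x - unitVec N μ ∉ A), conj (z x) * (z x - z (x - unitVec N μ))).re ) := by
  have hc : conj c * c = ((‖c‖ ^ 2 : ℝ) : ℂ) := by
    rw [← Complex.normSq_eq_norm_sq, Complex.normSq_eq_conj_mul_self]
  rw [sum_conj_mul_LapS_eq, hc, Complex.re_ofReal_mul, Complex.re_sum]
  congr 1
  refine Finset.sum_congr rfl fun μ _ => ?_
  simp only [Complex.add_re, Complex.re_sum, Complex.ofReal_re]

end Summit.QuantumFields.BalabanUV.Beta.GAN24.DirichletRingGreen

end
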